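import Summits.HodgeConjecture.HodgeConjecture.Theorems.F0P3OverrideWitnessOfLetters          -- ★ (F0P3): `specPkg_kitOfRecord_ghOfFibres_of_productForm`; brings ★ p822789 (this desk, ED. 1): `GTraceProductForm`, `HTraceProductForm`, `localExpansion_kitOfRecord`; ★ `F0P3GHSideOfFibres`; ★ `F0P3ClassificationBridgeV8`
import HarnessLib

/-!
# `F0P3bLocalExpansionAtKitOfRecordS0` — the two PRODUCT-TRACE clauses GUARDED BY THE LEVEL SET `S₀ ⊆ S` (RULING K4), and law (L6) `LocalExpansion S₀` (v8) at `𝔠₀`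

F0P3b desk (planner F0P3b-plan (g13), «ENGINE local packets», NAMING-ORDER-F0 v2 #7) — SUPERSEDE-NOT-EDIT companion (K4) of ★ `F0P3bLocalExpansionAtKitOfRecord`
(ED. 1, p822789; nothing there is edited): RULING K4 (LEAD F0P3a-plan (g10) WORD T9-14 (1), 2026-09-01T09:42:55Z; K3 census F0P3a-p08 (g14) row 4; F0P3a-p01 (g12)
09:38:58Z; REF1 (g9) 09:35:48Z ∕ 09:43:20Z; F0P3b-ref2 (g12) #17).

WHY.  ED. 1's H-side clause `HTraceProductForm` asserts the endoscopic product formula for `Tr ξ_S(f^H_S)` at EVERY finite set `S ⊇ ram ξ`.  Read against TRUE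
`S`-level traces (the tensor `f′_{S,∞} ⊗ 𝟙_{K′^S}`, `S`-trace ↔ global trace), the formula is the printed one only when, OFF `S`, the level `ψ_v(U(H)(𝒪_v))` IS the
hyperspecial level of record — i.e. for `S ⊇ S₀(H, ψ) := {v ∤ ∞ | (cmLocalIntegralLevel L 3 H v).map (ψ v) ≠ cmLocalIntegralLevel L 3 (splitForm L 3) v}` (p01 (g12):
admissibility `TestS₀ S` is silent on that set; the guard is free in print, [Rogawski1990 §14.6 p. 243 l. 3 «`S` contains the infinite places and all places where
some datum ramifies»; §13.7 p. 206]).  It is also exactly the guard under which the closer's letter binds `trGS`∕`trHS` to true traces (★ v8 `FactorisationPk 𝔠 S₀`,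
★ v8 `APacketSpectral 𝔠 … S₀`, ★ `SpectralPacketG.tr_partner_eq_trSψ_mul_prod` `(S₀) (hψK) (S) (hS₀ : S₀ ⊆ S) (hram)`), and the v8 law ★ `ClassificationKit.LocalExpansion S₀`
carries it already (`∀ ξ S, S₀ ⊆ S → ram ξ ⊆ S → …`).

WHAT IS HERE (statements + glue; no analysis).
* §1 `GTraceProductFormS₀ S₀`, `HTraceProductFormS₀ S₀` — ED. 1's two clauses with ONE extra binder `S₀ ⊆ S →` (v8 order: before `ram ξ ⊆ S →`); RESTATED-WEAKER:
  `…_of` (ED. 1's unguarded clause ⇒ the guarded one at every `S₀`), `…_mono` (`S₀ ⊆ S₀'`), `…_empty_iff` (guard `∅` ↔ ED. 1's clause).  The G-row twin is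
  symmetry only (K7 discharges the G-row definitionally); the H-row is RULING K4's repair of record for census row 4.
* §2 `localExpansion_kitOfRecord_S₀` — **law (L6) in its v8 form `LocalExpansion 𝔠₀ S₀` from `c = ±1` and the two GUARDED clauses**, by ★ V6's pointwise algebra
  `localExpansion_at_of_productForm` (so the unguarded detour ED. 1 → ★ `localExpansion_of_v6` is no longer needed by a consumer that only has the guarded rows).
* §3 at `gh := ghOfFibres …` (the closer's G∕H side): `specPkg_kitOfRecord_ghOfFibres_of_productFormS₀` and the one-variable form `…_of_forallS₀` — the guarded twins
  of ★ `F0P3OverrideWitnessOfLetters.specPkg_kitOfRecord_ghOfFibres_of_productForm` ∕ `…_of_forall`, for a «K9-STF» letter whose (P3′) is typed with the guard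
  (desk F0P3-plan: re-point `K9SpectralLetterSigned`'s (P3′) at `GTraceProductFormS₀ … S₀` ∕ `HTraceProductFormS₀ … S₀` with the tuple's own `S₀`, at the edition of
  your choosing — REF1 (g9): ED. 26 need not wait on it).

No `sorry`, no new axiom, no instance, no notation; Theorems never import Lines.
HONEST LABEL: HC_CM is proved only modulo the 2 remaining named inputs (hLiu418, h413) until rung 0 closes.
-/

set_option autoImplicit false
set_option linter.dupNamespace false

noncomputable section

open NumberField IsDedekindDomain MeasureTheory
open Literature.NumberTheory.Rogawski1990 Literature.NumberTheory.GaloisRepresentations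
open Literature.NumberTheory.Automorphic Literature.NumberTheory.Automorphic.UnitaryGroup
open scoped Matrix ComplexOrder BigOperators Classical

namespace Summit.HodgeConjecture.HodgeConjecture.Cruxes.H413.F0P3bLocalExpansionAtKitOfRecord

open Summit.HodgeConjecture.HodgeConjecture.Cruxes.H413.F0P3InnerFormClassificationV6
open Summit.HodgeConjecture.HodgeConjecture.Cruxes.H413.F0P3InnerFormClassificationV6.ClassificationKit (memberCoeff)
open Summit.HodgeConjecture.HodgeConjecture.Cruxes.H413.F0P3SemilocalTestFunctionsOfRecord (TestS₀ tens₀)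
open Summit.HodgeConjecture.HodgeConjecture.Cruxes.H413.F0P3TestFunctionsOfRecord (Unr₀)
open Summit.HodgeConjecture.HodgeConjecture.Cruxes.H413.F0P3XiArchDataOfRecord (nCompactOfRecord)
open Summit.HodgeConjecture.HodgeConjecture.Cruxes.H413.F0P3XiArchPacketOfRecord (archPacketOfRecord)
open Summit.HodgeConjecture.HodgeConjecture.Cruxes.H413.F0P3KitOfRecord (GHSide XiSide cptXi₀ kitOfRecord)
open Summit.HodgeConjecture.HodgeConjecture.Cruxes.H413.F0P3bLocalExpansionOfProductFormV6 (localExpansion_at_of_productForm)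
open Summit.HodgeConjecture.HodgeConjecture.Cruxes.H413.F0P3GHSideOfFibres (ghOfFibres matchingS_kitOfRecord_ghOfFibres transferS_kitOfRecord_ghOfFibres)

variable (L : Type) [Field L] [NumberField L] [IsCMField L] (H : Matrix (Fin 3) (Fin 3) L) (ι : L →+* ℂ) (T : GL (Fin 3) ℂ)
  (hT : (T : Matrix (Fin 3) (Fin 3) ℂ)ᴴ * H.map ι * (T : Matrix (Fin 3) (Fin 3) ℂ) = Literature.Geometry.ComplexHyperbolic.BallModel.J)
  (μ : Measure (Gp L H).automorphicQuotient) [(Gp L H).IsAutomorphicMeasure μ]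

/-! ## §1 The two product-trace clauses, guarded by `S₀ ⊆ S` -/

section Clauses

variable {L H μ}
variable {PG PH : Type} (gh : GHSide L H ι T hT PG PH) (ξd : XiSide L H PG PH)
  (μω : HeckeCharacter L) (c : ℚ) (jInf dsInf : ℤ → ℤ → ℤ → Cinf)
  (archTr : Cinf → (UnitaryGroup.arch (↥(maximalRealSubfield L)) L (IsCMField.complexConj L) 3 H → ℂ) → ℂ)

/-- **`GTraceProductFormS₀ S₀`** — ED. 1's G-side PRODUCT-TRACE clause ★ `GTraceProductForm` asked only at the finite sets `S ⊇ S₀` (and `S ⊇ ram ξ`): the `S`-level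
trace of the packet `Π(ξ)` is the compact factor times `(−1)^N` times the STABLE packet characters (`ε = −1`).  Symmetry twin of the K4 row (the G-row is K7's,
definitional at the carriers of record). [cite: Rogawski1990, §13.1 13.1.3 (b) p. 199; §12.3 12.3.3 (b) p. 178; §14.6 p. 243 l. 3, p. 244] -/
def GTraceProductFormS₀ (S₀ : Finset (Places L)) (μv : ∀ v : Places L, @Measure ((cmDatum L 3 H).Local v) (borel _)) : Prop :=
  ∀ (ξ : OneDimAutRepH L) (S : Finset (Places L)), S₀ ⊆ S → ξd.ram ξ ⊆ S →
    ∀ (fS : TestS₀ L H ι T hT S) (fSG : gh.TestSG S) (fSH : gh.TestSH S), gh.MatchesS S fS fSG fSH →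
      gh.trGS S (ξd.PiXi ξ) fSG = (if cptXi₀ ι μω ξ then 1 else 0) * (-1) ^ nCompactOfRecord L *
        ((∑ᶠ y, (memberCoeff (archPacketOfRecord ι μω jInf dsInf ξ) (-1) y : ℂ) * archTr y fS.arch) *
          ∏ v : ↥S, ∑ᶠ z, (memberCoeff (ξd.packFin ξ v.1) (-1) z : ℂ) *
            (letI : MeasurableSpace ((cmDatum L 3 H).Local v.1) := borel _; z.smoothTrace (μv v.1) (fS.loc v)))

/-- **`HTraceProductFormS₀ S₀`** (RULING K4, repair of record for K3 census row 4) — ED. 1's H-side PRODUCT-TRACE clause ★ `HTraceProductForm` asked only at the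
finite sets `S ⊇ S₀` (and `S ⊇ ram ξ`): `Tr ξ_S(f^H_S)` is the compact factor times `(−1)^N · c` times the ENDOSCOPIC sums `(A πⁿ_ι + A πˢ_ι) · ∏_{v ∈ S} (Tr πⁿ_v + Tr πˢ_v)(f′_v)`.
Intended `S₀ ⊇ S₀(H, ψ) = {v ∤ ∞ | ψ_v(U(H)(𝒪_v)) ≠ the hyperspecial level of record}` (the witness's choice; consumers union their bad sets, ★ `LocalExpansion.mono`).
[cite: Rogawski1990, §13.1 Prop. 13.1.4 p. 199; §12.3 12.3.3 (a) p. 178; §13.7 p. 206; §14.6 p. 243 l. 3 – p. 244 l. 17] -/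
def HTraceProductFormS₀ (S₀ : Finset (Places L)) (μv : ∀ v : Places L, @Measure ((cmDatum L 3 H).Local v) (borel _)) : Prop :=
  ∀ (ξ : OneDimAutRepH L) (S : Finset (Places L)), S₀ ⊆ S → ξd.ram ξ ⊆ S →
    ∀ (fS : TestS₀ L H ι T hT S) (fSG : gh.TestSG S) (fSH : gh.TestSH S), gh.MatchesS S fS fSG fSH →
      gh.trHS S (ξd.ρXi ξ) fSH = (if cptXi₀ ι μω ξ then 1 else 0) * (-1) ^ nCompactOfRecord L * (c : ℂ) *
        ((∑ᶠ y, (memberCoeff (archPacketOfRecord ι μω jInf dsInf ξ) 1 y : ℂ) * archTr y fS.arch) *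
          ∏ v : ↥S, ∑ᶠ z, (memberCoeff (ξd.packFin ξ v.1) 1 z : ℂ) *
            (letI : MeasurableSpace ((cmDatum L 3 H).Local v.1) := borel _; z.smoothTrace (μv v.1) (fS.loc v)))

variable (μv : ∀ v : Places L, @Measure ((cmDatum L 3 H).Local v) (borel _))

/-- RESTATED-WEAKER: ED. 1's unguarded G-row gives the guarded one at every `S₀`. [folklore] -/
theorem gTraceProductFormS₀_of (S₀ : Finset (Places L)) (h : GTraceProductForm ι T hT gh ξd μω jInf dsInf archTr μv) :
    GTraceProductFormS₀ ι T hT gh ξd μω jInf dsInf archTr S₀ μv :=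
  fun ξ S _ hS => h ξ S hS

/-- RESTATED-WEAKER: ED. 1's unguarded H-row gives the guarded one at every `S₀`. [folklore] -/
theorem hTraceProductFormS₀_of (S₀ : Finset (Places L)) (h : HTraceProductForm ι T hT gh ξd μω c jInf dsInf archTr μv) :
    HTraceProductFormS₀ ι T hT gh ξd μω c jInf dsInf archTr S₀ μv :=
  fun ξ S _ hS => h ξ S hS

/-- The guarded G-row is preserved under ENLARGING the guard. [folklore] -/
theorem GTraceProductFormS₀.mono {S₀ S₀' : Finset (Places L)} (hle : S₀ ⊆ S₀')
    (h : GTraceProductFormS₀ ι T hT gh ξd μω jInf dsInf archTr S₀ μv) : GTraceProductFormS₀ ι T hT gh ξd μω jInf dsInf archTr S₀' μv :=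
  fun ξ S hS₀ hS => h ξ S (hle.trans hS₀) hS

/-- The guarded H-row is preserved under ENLARGING the guard (consumers union the bad sets of their letters). [folklore] -/
theorem HTraceProductFormS₀.mono {S₀ S₀' : Finset (Places L)} (hle : S₀ ⊆ S₀')
    (h : HTraceProductFormS₀ ι T hT gh ξd μω c jInf dsInf archTr S₀ μv) : HTraceProductFormS₀ ι T hT gh ξd μω c jInf dsInf archTr S₀' μv :=
  fun ξ S hS₀ hS => h ξ S (hle.trans hS₀) hS

/-- At the EMPTY guard the guarded G-row IS ED. 1's row. [folklore] -/
theorem gTraceProductFormS₀_empty_iff :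
    GTraceProductFormS₀ ι T hT gh ξd μω jInf dsInf archTr ∅ μv ↔ GTraceProductForm ι T hT gh ξd μω jInf dsInf archTr μv :=
  ⟨fun h ξ S hS => h ξ S (Finset.empty_subset S) hS, fun h => gTraceProductFormS₀_of ι T hT gh ξd μω jInf dsInf archTr μv ∅ h⟩

/-- At the EMPTY guard the guarded H-row IS ED. 1's row. [folklore] -/
theorem hTraceProductFormS₀_empty_iff :
    HTraceProductFormS₀ ι T hT gh ξd μω c jInf dsInf archTr ∅ μv ↔ HTraceProductForm ι T hT gh ξd μω c jInf dsInf archTr μv :=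
  ⟨fun h ξ S hS => h ξ S (Finset.empty_subset S) hS, fun h => hTraceProductFormS₀_of ι T hT gh ξd μω c jInf dsInf archTr μv ∅ h⟩

end Clauses

/-! ## §2 (L6) in v8 form `LocalExpansion 𝔠₀ S₀` from the guarded clauses -/

section AtKitOfRecord

variable {L H μ}
variable (𝔰 : Sockets L H μ) (gh : GHSide L H ι T hT 𝔰.PacketG 𝔰.PacketH) (ξd : XiSide L H 𝔰.PacketG 𝔰.PacketH)
  (μω : HeckeCharacter L) (c : ℚ) (jInf dsInf : ℤ → ℤ → ℤ → Cinf)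
  (archTr : Cinf → (UnitaryGroup.arch (↥(maximalRealSubfield L)) L (IsCMField.complexConj L) 3 H → ℂ) → ℂ)
  [MeasurableSpace (Gp L H).Adelic] [BorelSpace (Gp L H).Adelic] (ν : Measure (Gp L H).Adelic) [IsFiniteMeasureOnCompacts ν]
  (μv : ∀ v : Places L, @Measure ((cmDatum L 3 H).Local v) (borel _))
  (ramCls₀ : DiscreteAutomorphicRep (Gp L H) μ → Set (Places L))

/-- **(L6) AT THE KIT OF RECORD, v8 GUARDED FORM.**  If `c = ±1` (R-21) and the bundled G∕H side `gh` satisfies the two product-trace clauses AT THE SETS `S ⊇ S₀`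
(`GTraceProductFormS₀ S₀`, `HTraceProductFormS₀ S₀`), then the v8 law `LocalExpansion 𝔠₀ S₀` — `c(ξ) = ±1`, finiteness, and the two-term expansion (14.6.3)
`½ Tr Π(ξ)_S(f_S) + ½ Tr ξ_S(f^H_S) = Σ_x E_ξ(x) · ch_x(f_S)` at every `ξ`, `S ⊇ S₀ ∪ ram ξ` and matched data — holds at `𝔠₀ = kitOfRecord …` (★ V6 pointwise algebra
`localExpansion_at_of_productForm`). [cite: Rogawski1990, §14.6 Thm. 14.6.4, (14.6.3) p. 244 ll. 6–17; p. 243 l. 3; §13.1 p. 199; §12.3 p. 178] -/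
theorem localExpansion_kitOfRecord_S₀ (S₀ : Finset (Places L)) (hc : c = 1 ∨ c = -1)
    (hG : GTraceProductFormS₀ ι T hT gh ξd μω jInf dsInf archTr S₀ μv) (hH : HTraceProductFormS₀ ι T hT gh ξd μω c jInf dsInf archTr S₀ μv) :
    F0P3InnerFormClassificationV8.ClassificationKit.LocalExpansion (kitOfRecord L H ι T hT μ 𝔰 gh ξd μω c jInf dsInf archTr ν μv ramCls₀) S₀ := by
  intro ξ S hS₀ hS
  refine ⟨hc, fun fS fSG fSH hm => ?_⟩
  exact localExpansion_at_of_productForm _ ξ S fS fSG fSH (fun y => archTr y fS.arch)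
    (fun v z => (letI : MeasurableSpace ((cmDatum L 3 H).Local v.1) := borel _; z.smoothTrace (μv v.1) (fS.loc v)))
    (fun _ => rfl) (hG ξ S hS₀ hS fS fSG fSH hm) (hH ξ S hS₀ hS fS fSG fSH hm)

/-- ED. 1's unguarded (L6)-at-`𝔠₀` through the guarded door (consistency check: the guarded theorem applied to the weakened rows agrees with ★ `localExpansion_of_v6 ∘
localExpansion_kitOfRecord` as a statement). [folklore] -/
theorem localExpansion_kitOfRecord_S₀_of_productForm (S₀ : Finset (Places L)) (hc : c = 1 ∨ c = -1)
    (hG : GTraceProductForm ι T hT gh ξd μω jInf dsInf archTr μv) (hH : HTraceProductForm ι T hT gh ξd μω c jInf dsInf archTr μv) :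
    F0P3InnerFormClassificationV8.ClassificationKit.LocalExpansion (kitOfRecord L H ι T hT μ 𝔰 gh ξd μω c jInf dsInf archTr ν μv ramCls₀) S₀ :=
  localExpansion_kitOfRecord_S₀ ι T hT 𝔰 gh ξd μω c jInf dsInf archTr ν μv ramCls₀ S₀ hc
    (gTraceProductFormS₀_of ι T hT gh ξd μω jInf dsInf archTr μv S₀ hG) (hTraceProductFormS₀_of ι T hT gh ξd μω c jInf dsInf archTr μv S₀ hH)

end AtKitOfRecord

/-! ## §3 At the G∕H side of fibres: `SpecPkg 𝔠₀ S₀` from the GUARDED residual clauses -/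

section Fibres

variable {L H μ}
variable (𝔰 : Sockets L H μ) (hg : ∀ f' : TestGp L H, 𝔰.Smooth f' → ∃ (f : TestG L) (fH : TestH L), 𝔰.Matches f' f fH)
  (hsm : ∀ (S : Finset (Places L)) (fS : TestS₀ L H ι T hT S) (fT : Unr₀ L H S), 𝔰.Smooth (tens₀ S fS fT))
  (trGS : ∀ S : Finset (Places L), 𝔰.PacketG → TestS₀ L H ι T hT S → ℂ) (trHS : ∀ S : Finset (Places L), 𝔰.PacketH → TestS₀ L H ι T hT S → ℂ)
  (ξd : XiSide L H 𝔰.PacketG 𝔰.PacketH) (μω : HeckeCharacter L) (c : ℚ) (jInf dsInf : ℤ → ℤ → ℤ → Cinf)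
  (archTr : Cinf → (UnitaryGroup.arch (↥(maximalRealSubfield L)) L (IsCMField.complexConj L) 3 H → ℂ) → ℂ)
  (μv : ∀ v : Places L, @Measure ((cmDatum L 3 H).Local v) (borel _))

/-- **`GTraceProductFormS₀` at `gh := ghOfFibres …` from its GUARDED one-variable form** (`fSG = fS` on the fibre side). [cite: Rogawski1990, §13.1 13.1.3 (b) p. 199; §12.3 12.3.3 (b) p. 178; §14.6 p. 244] -/
theorem gTraceProductFormS₀_ghOfFibres_of_forall (S₀ : Finset (Places L))
    (h : ∀ (ξ : OneDimAutRepH L) (S : Finset (Places L)), S₀ ⊆ S → ξd.ram ξ ⊆ S → ∀ (fS : TestS₀ L H ι T hT S),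
      trGS S (ξd.PiXi ξ) fS = (if cptXi₀ ι μω ξ then 1 else 0) * (-1) ^ nCompactOfRecord L *
        ((∑ᶠ y, (memberCoeff (archPacketOfRecord ι μω jInf dsInf ξ) (-1) y : ℂ) * archTr y fS.arch) *
          ∏ v : ↥S, ∑ᶠ z, (memberCoeff (ξd.packFin ξ v.1) (-1) z : ℂ) *
            (letI : MeasurableSpace ((cmDatum L 3 H).Local v.1) := borel _; z.smoothTrace (μv v.1) (fS.loc v)))) :
    GTraceProductFormS₀ ι T hT (ghOfFibres ι T hT 𝔰 hg hsm trGS trHS) ξd μω jInf dsInf archTr S₀ μv := by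
  intro ξ S hS₀ hS fS fSG fSH hm
  obtain ⟨h1, -⟩ := hm
  rw [h1]
  exact h ξ S hS₀ hS fS

/-- **`HTraceProductFormS₀` at `gh := ghOfFibres …` from its GUARDED one-variable form** (`fSH = fS` on the fibre side) — the endoscopic character identities asked at
`S ⊇ S₀ ∪ ram ξ`. [cite: Rogawski1990, §13.1 Prop. 13.1.4 p. 199; §12.3 12.3.3 (a) p. 178; §14.6 p. 243 l. 3 – p. 244 l. 17] -/
theorem hTraceProductFormS₀_ghOfFibres_of_forall (S₀ : Finset (Places L))
    (h : ∀ (ξ : OneDimAutRepH L) (S : Finset (Places L)), S₀ ⊆ S → ξd.ram ξ ⊆ S → ∀ (fS : TestS₀ L H ι T hT S),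
      trHS S (ξd.ρXi ξ) fS = (if cptXi₀ ι μω ξ then 1 else 0) * (-1) ^ nCompactOfRecord L * (c : ℂ) *
        ((∑ᶠ y, (memberCoeff (archPacketOfRecord ι μω jInf dsInf ξ) 1 y : ℂ) * archTr y fS.arch) *
          ∏ v : ↥S, ∑ᶠ z, (memberCoeff (ξd.packFin ξ v.1) 1 z : ℂ) *
            (letI : MeasurableSpace ((cmDatum L 3 H).Local v.1) := borel _; z.smoothTrace (μv v.1) (fS.loc v)))) :
    HTraceProductFormS₀ ι T hT (ghOfFibres ι T hT 𝔰 hg hsm trGS trHS) ξd μω c jInf dsInf archTr S₀ μv := by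
  intro ξ S hS₀ hS fS fSG fSH hm
  obtain ⟨-, h2⟩ := hm
  rw [h2]
  exact h ξ S hS₀ hS fS

variable [MeasurableSpace (Gp L H).Adelic] [BorelSpace (Gp L H).Adelic] (ν : Measure (Gp L H).Adelic) [IsFiniteMeasureOnCompacts ν]
  (ramCls₀ : DiscreteAutomorphicRep (Gp L H) μ → Set (Places L))

/-- **`SpecPkg 𝔠₀ S₀` FROM THE GUARDED (P)-CLAUSES** at `𝔠₀ := kitOfRecord … 𝔰 (ghOfFibres …) ξd …`: `factorisationPk`, `aPacketSpectral` passed through; `matchingS` ∕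
`transferS` BY CONSTRUCTION (★ K9-0a(a)); `localExpansion` = §2 fed with `c = ±1` and the two product-trace clauses AT `S ⊇ S₀` — the guarded twin of
★ `F0P3OverrideWitnessOfLetters.specPkg_kitOfRecord_ghOfFibres_of_productForm`. [cite: Rogawski1990, §14.6 Thm. 14.6.1 p. 241; Thm. 14.6.4 (14.6.3) p. 244; §13.3 Thm. 13.3.7]
[cite: FlathCorvallis1979, Thm. 3] -/
theorem specPkg_kitOfRecord_ghOfFibres_of_productFormS₀ (S₀ : Finset (Places L)) (hc : c = 1 ∨ c = -1)
    (hP1 : F0P3InnerFormClassificationV8.ClassificationKit.FactorisationPk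
      (kitOfRecord L H ι T hT μ 𝔰 (ghOfFibres ι T hT 𝔰 hg hsm trGS trHS) ξd μω c jInf dsInf archTr ν μv ramCls₀) S₀)
    (hP2 : F0P3InnerFormClassificationV8.ClassificationKit.APacketSpectral
      (kitOfRecord L H ι T hT μ 𝔰 (ghOfFibres ι T hT 𝔰 hg hsm trGS trHS) ξd μω c jInf dsInf archTr ν μv ramCls₀) S₀)
    (hG : GTraceProductFormS₀ ι T hT (ghOfFibres ι T hT 𝔰 hg hsm trGS trHS) ξd μω jInf dsInf archTr S₀ μv)
    (hH : HTraceProductFormS₀ ι T hT (ghOfFibres ι T hT 𝔰 hg hsm trGS trHS) ξd μω c jInf dsInf archTr S₀ μv) :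
    F0P3InnerFormClassificationV8.ClassificationKit.SpecPkg
      (kitOfRecord L H ι T hT μ 𝔰 (ghOfFibres ι T hT 𝔰 hg hsm trGS trHS) ξd μω c jInf dsInf archTr ν μv ramCls₀) S₀ :=
  ⟨hP1, matchingS_kitOfRecord_ghOfFibres ι T hT 𝔰 hg hsm trGS trHS ξd μω c jInf dsInf archTr ν μv ramCls₀ S₀,
    transferS_kitOfRecord_ghOfFibres ι T hT 𝔰 hg hsm trGS trHS ξd μω c jInf dsInf archTr ν μv ramCls₀ S₀, hP2,
    localExpansion_kitOfRecord_S₀ ι T hT 𝔰 (ghOfFibres ι T hT 𝔰 hg hsm trGS trHS) ξd μω c jInf dsInf archTr ν μv ramCls₀ S₀ hc hG hH⟩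

/-- **`SpecPkg 𝔠₀ S₀` from the GUARDED one-variable clauses** (the shape a «K9-STF» letter states them in). [cite: Rogawski1990, §13.1 p. 199; §12.3 p. 178; §14.6 Thm. 14.6.4 p. 244]
[cite: FlathCorvallis1979, Thm. 3] -/
theorem specPkg_kitOfRecord_ghOfFibres_of_forallS₀ (S₀ : Finset (Places L)) (hc : c = 1 ∨ c = -1)
    (hP1 : F0P3InnerFormClassificationV8.ClassificationKit.FactorisationPk
      (kitOfRecord L H ι T hT μ 𝔰 (ghOfFibres ι T hT 𝔰 hg hsm trGS trHS) ξd μω c jInf dsInf archTr ν μv ramCls₀) S₀)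
    (hP2 : F0P3InnerFormClassificationV8.ClassificationKit.APacketSpectral
      (kitOfRecord L H ι T hT μ 𝔰 (ghOfFibres ι T hT 𝔰 hg hsm trGS trHS) ξd μω c jInf dsInf archTr ν μv ramCls₀) S₀)
    (hGf : ∀ (ξ : OneDimAutRepH L) (S : Finset (Places L)), S₀ ⊆ S → ξd.ram ξ ⊆ S → ∀ (fS : TestS₀ L H ι T hT S),
      trGS S (ξd.PiXi ξ) fS = (if cptXi₀ ι μω ξ then 1 else 0) * (-1) ^ nCompactOfRecord L *
        ((∑ᶠ y, (memberCoeff (archPacketOfRecord ι μω jInf dsInf ξ) (-1) y : ℂ) * archTr y fS.arch) *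
          ∏ v : ↥S, ∑ᶠ z, (memberCoeff (ξd.packFin ξ v.1) (-1) z : ℂ) *
            (letI : MeasurableSpace ((cmDatum L 3 H).Local v.1) := borel _; z.smoothTrace (μv v.1) (fS.loc v))))
    (hHf : ∀ (ξ : OneDimAutRepH L) (S : Finset (Places L)), S₀ ⊆ S → ξd.ram ξ ⊆ S → ∀ (fS : TestS₀ L H ι T hT S),
      trHS S (ξd.ρXi ξ) fS = (if cptXi₀ ι μω ξ then 1 else 0) * (-1) ^ nCompactOfRecord L * (c : ℂ) *
        ((∑ᶠ y, (memberCoeff (archPacketOfRecord ι μω jInf dsInf ξ) 1 y : ℂ) * archTr y fS.arch) *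
          ∏ v : ↥S, ∑ᶠ z, (memberCoeff (ξd.packFin ξ v.1) 1 z : ℂ) *
            (letI : MeasurableSpace ((cmDatum L 3 H).Local v.1) := borel _; z.smoothTrace (μv v.1) (fS.loc v)))) :
    F0P3InnerFormClassificationV8.ClassificationKit.SpecPkg
      (kitOfRecord L H ι T hT μ 𝔰 (ghOfFibres ι T hT 𝔰 hg hsm trGS trHS) ξd μω c jInf dsInf archTr ν μv ramCls₀) S₀ :=
  specPkg_kitOfRecord_ghOfFibres_of_productFormS₀ ι T hT 𝔰 hg hsm trGS trHS ξd μω c jInf dsInf archTr μv ν ramCls₀ S₀ hc hP1 hP2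
    (gTraceProductFormS₀_ghOfFibres_of_forall ι T hT 𝔰 hg hsm trGS trHS ξd μω jInf dsInf archTr μv S₀ hGf)
    (hTraceProductFormS₀_ghOfFibres_of_forall ι T hT 𝔰 hg hsm trGS trHS ξd μω c jInf dsInf archTr μv S₀ hHf)

end Fibres

/-! ### TRIO (read-backs) -/

section Trio

variable {L H μ}
variable {PG PH : Type} (gh : GHSide L H ι T hT PG PH) (ξd : XiSide L H PG PH)
  (μω : HeckeCharacter L) (c : ℚ) (jInf dsInf : ℤ → ℤ → ℤ → Cinf)
  (archTr : Cinf → (UnitaryGroup.arch (↥(maximalRealSubfield L)) L (IsCMField.complexConj L) 3 H → ℂ) → ℂ)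
  (μv : ∀ v : Places L, @Measure ((cmDatum L 3 H).Local v) (borel _))

/-- TRIO: the guarded H-row unfolds by `Iff.rfl` to ED. 1's equation behind the two binders `S₀ ⊆ S → ram ξ ⊆ S →`. -/
example (S₀ : Finset (Places L)) : HTraceProductFormS₀ ι T hT gh ξd μω c jInf dsInf archTr S₀ μv ↔
    ∀ (ξ : OneDimAutRepH L) (S : Finset (Places L)), S₀ ⊆ S → ξd.ram ξ ⊆ S →
      ∀ (fS : TestS₀ L H ι T hT S) (fSG : gh.TestSG S) (fSH : gh.TestSH S), gh.MatchesS S fS fSG fSH →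
        gh.trHS S (ξd.ρXi ξ) fSH = (if cptXi₀ ι μω ξ then 1 else 0) * (-1) ^ nCompactOfRecord L * (c : ℂ) *
          ((∑ᶠ y, (memberCoeff (archPacketOfRecord ι μω jInf dsInf ξ) 1 y : ℂ) * archTr y fS.arch) *
            ∏ v : ↥S, ∑ᶠ z, (memberCoeff (ξd.packFin ξ v.1) 1 z : ℂ) *
              (letI : MeasurableSpace ((cmDatum L 3 H).Local v.1) := borel _; z.smoothTrace (μv v.1) (fS.loc v))) :=
  Iff.rfl

/-- TRIO: a strictly larger guard asks strictly less — the guarded row at `S₀'` follows from the row at any `S₀ ⊆ S₀'`, in particular from ED. 1's row (`S₀ = ∅`). -/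
example (S₀' : Finset (Places L)) (h : HTraceProductForm ι T hT gh ξd μω c jInf dsInf archTr μv) :
    HTraceProductFormS₀ ι T hT gh ξd μω c jInf dsInf archTr S₀' μv :=
  HTraceProductFormS₀.mono ι T hT gh ξd μω c jInf dsInf archTr μv (Finset.empty_subset S₀')
    ((hTraceProductFormS₀_empty_iff ι T hT gh ξd μω c jInf dsInf archTr μv).2 h)

end Trio

end Summit.HodgeConjecture.HodgeConjecture.Cruxes.H413.F0P3bLocalExpansionAtKitOfRecord

end
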